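import Literature.Computability.Cryptography.LWEBinaryNoiseCloseness
import Literature.Algebra.EuclideanLattices.ScaledIntLattice
import HarnessLib

/-!
# BLPRS 2013, Lemma 4.9, first hybrid: the noise closeness INSTANTIATED on `Q⁻¹ℤⁿ` (`Δ ≤ 4ε` under Lemma 2.5's smoothing condition)

Topic `Computability/Cryptography` (LWE), grouping namespace `LWE`. Closes the loop between
`LWEBinaryNoiseCloseness.lean` (`tvDist_noiseH₁_discretizedGaussian_le`: abstract lattice `L` with a
`ℤ`-basis `b`, a representing vector `z_E` with `⟪z_E, x⟫ = ⟨coords x, z⟩/Q`, hypothesis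
`η_ε(L) ≤ 1/√(1/r² + (‖z_E‖/γ)²)`) and the tree's concrete lattice `invScaledIntLattice n Q = Q⁻¹ℤⁿ`
(`ScaledIntLattice.lean`: basis `invScaledBasis = (Q⁻¹eⱼ)ⱼ`, BLPRS Lemma 2.5
`smoothingParameter_invScaledIntLattice_le`). Proved (no named fact) towards pqc.S21:

* `invScaledBasisZ n Q` — the `ℤ`-basis `(Q⁻¹eⱼ)ⱼ` of `Q⁻¹ℤⁿ` (`restrictScalars`), `cast_invScaledBasisZ_repr`
  (its coordinates are the integer numerators `Q·xⱼ`, `= ScaledIntLattice.num`);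
* `inner_toLp_intCast_eq_repr_dotProduct_div` — the pairing hypothesis holds with `z_E = z̄ = toLp z`;
  `norm_toLp_intCast_sq` (`‖z̄‖² = ∑ zⱼ²`), `norm_toLp_intCast_sq_le_of_binary` (`≤ n` for binary `z`);
* **`tvDist_noiseH₁_invScaled_le`** — for `χ_N = latticeNoiseLaw (invScaledBasisZ n Q) r` (the coordinates
  `Qv` of a column `v ← D_{Q⁻¹ℤⁿ,r}`) and `χ_h = Ψ̄_γ`:
  `Δ(noiseH₁ χ_N Ψ̄_γ z̄, Ψ̄_{√(‖z̄‖²r² + γ²)}) ≤ 4ε` provided `Q⁻¹√(ln(2n(1+1/ε))/π) ≤ 1/√(1/r² + (‖z̄‖/γ)²)`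
  (Lemma 2.5 ∘ Lemma 2.9), and `tvDist_noiseH₁_invScaled_le_of_binary` with `‖z̄‖² ≤ n` for binary `z`
  (the printed use: "Using `‖z‖ ≤ √n` and that `β ≥ √2η_ε(ℤⁿ)/q` … by Lemma 2.9").

## References

* Z. Brakerski, A. Langlois, C. Peikert, O. Regev, D. Stehlé, *Classical hardness of learning with errors*,
  STOC 2013; arXiv:1306.0281, Lemmas 2.5, 2.9 and the proof of Lemma 4.9 (first hybrid).
-/

noncomputable section

open MeasureTheory ProbabilityTheory Module Literature.Algebra.EuclideanLattices Matrix
open scoped Real ENNReal RealInnerProductSpace NNReal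

namespace Literature.Computability.Cryptography

namespace LWE

variable (n Q : ℕ) [NeZero Q]

/-- **The `ℤ`-basis `(Q⁻¹eⱼ)ⱼ` of `Q⁻¹ℤⁿ`.** [cite: BrakerskiEtAl2013, §2.3] -/
def invScaledBasisZ : Basis (Fin n) ℤ (invScaledIntLattice n Q) :=
  (invScaledBasis n Q).restrictScalars ℤ

variable {n Q}

/-- The integer coordinates in `invScaledBasisZ` are the numerators: `((repr x) j : ℝ) = Q · xⱼ`. [folklore] -/
theorem cast_invScaledBasisZ_repr (x : invScaledIntLattice n Q) (j : Fin n) :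
    (((invScaledBasisZ n Q).repr x j : ℤ) : ℝ) = Q * (x : EuclideanSpace ℝ (Fin n)) j := by
  rw [invScaledBasisZ, ← invScaledBasis_repr n Q (x : EuclideanSpace ℝ (Fin n)) j,
    ← Basis.restrictScalars_repr_apply ℤ (invScaledBasis n Q) x j]
  rfl

/-- The coordinates agree with `ScaledIntLattice.num`. [folklore] -/
theorem invScaledBasisZ_repr_eq_num (x : invScaledIntLattice n Q) (j : Fin n) :
    (invScaledBasisZ n Q).repr x j = num n Q x j := by
  have h := cast_invScaledBasisZ_repr x j
  rw [← num_spec n Q x j] at h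
  exact_mod_cast h

/-- **The pairing hypothesis of `LWEBinaryNoiseCloseness` holds for `z_E = z̄`**: for an integer vector `z`
and `x ∈ Q⁻¹ℤⁿ`, `⟪z̄, x⟫ = ⟨coords x, z⟩/Q`. [cite: BrakerskiEtAl2013, Lemma 4.9 (proof, "-Nᵀz")] -/
theorem inner_toLp_intCast_eq_repr_dotProduct_div (z : Fin n → ℤ) (x : invScaledIntLattice n Q) :
    ⟪WithLp.toLp 2 (fun j => (z j : ℝ)), (x : EuclideanSpace ℝ (Fin n))⟫ =
      ((((fun j => (invScaledBasisZ n Q).repr x j) ⬝ᵥ z : ℤ)) : ℝ) / Q := by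
  have hQ : (Q : ℝ) ≠ 0 := by exact_mod_cast NeZero.ne Q
  rw [EuclideanSpace.inner_eq_star_dotProduct, star_trivial, dotProduct, dotProduct, Int.cast_sum,
    Finset.sum_div]
  refine Finset.sum_congr rfl fun j _ => ?_
  rw [WithLp.ofLp_toLp, Int.cast_mul, cast_invScaledBasisZ_repr]
  field_simp

/-- `‖z̄‖² = ∑ⱼ zⱼ²`. [folklore] -/
theorem norm_toLp_intCast_sq (z : Fin n → ℤ) :
    ‖WithLp.toLp 2 (fun j => (z j : ℝ))‖ ^ 2 = ∑ j, (z j : ℝ) ^ 2 := by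
  rw [EuclideanSpace.norm_sq_eq]
  simp

/-- For a binary `z`, `‖z̄‖² ≤ n` ("Using `‖z‖ ≤ √n`"). [cite: BrakerskiEtAl2013, Lemma 4.9 (proof)] -/
theorem norm_toLp_intCast_sq_le_of_binary {z : Fin n → ℤ} (hz : ∀ j, z j = 0 ∨ z j = 1) :
    ‖WithLp.toLp 2 (fun j => (z j : ℝ))‖ ^ 2 ≤ n := by
  rw [norm_toLp_intCast_sq]
  calc ∑ j, (z j : ℝ) ^ 2 ≤ ∑ _j : Fin n, (1 : ℝ) := Finset.sum_le_sum fun j _ => by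
          rcases hz j with h | h <;> simp [h]
    _ = n := by simp

/-- **Lemma 2.9 for the noise of `H₁` on `Q⁻¹ℤⁿ`, with Lemma 2.5's smoothing condition**: for
`χ_N = latticeNoiseLaw (invScaledBasisZ n Q) r` (the integer coordinates `Qv` of `v ← D_{Q⁻¹ℤⁿ,r}`),
`0 < ε ≤ 1/2`, `0 < r, γ`, and `Q⁻¹√(ln(2n(1+1/ε))/π) ≤ 1/√(1/r² + (‖z̄‖/γ)²)`:
`Δ(noiseH₁ χ_N Ψ̄_γ z̄, Ψ̄_{√(‖z̄‖²r² + γ²)}) ≤ 4ε`. [cite: BrakerskiEtAl2013, Lemmas 2.5, 2.9 and 4.9 (proof)] -/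
theorem tvDist_noiseH₁_invScaled_le {ε r γ : ℝ} (hε : 0 < ε) (hε' : ε ≤ 1 / 2) (hr : 0 < r) (hγ : 0 < γ)
    (z : Fin n → ℤ)
    (hsmooth : (Q : ℝ)⁻¹ * Real.sqrt (Real.log (2 * n * (1 + 1 / ε)) / π) ≤
      1 / Real.sqrt (1 / r ^ 2 + (‖WithLp.toLp 2 (fun j => (z j : ℝ))‖ / γ) ^ 2)) :
    (noiseH₁ (latticeNoiseLaw (invScaledBasisZ n Q) r) (discretizedGaussian Q γ) (intCastVec z : Fin n → ZMod Q)).tvDist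
        (discretizedGaussian Q (Real.sqrt (‖WithLp.toLp 2 (fun j => (z j : ℝ))‖ ^ 2 * r ^ 2 + γ ^ 2))) ≤ 4 * ε :=
  tvDist_noiseH₁_discretizedGaussian_le (invScaledBasisZ n Q) Q hε hε' hr hγ z _
    (inner_toLp_intCast_eq_repr_dotProduct_div z)
    ((smoothingParameter_invScaledIntLattice_le n Q hε).trans hsmooth)

/-- The binary form: with `‖z̄‖² ≤ n`, it suffices that `Q⁻¹√(ln(2n(1+1/ε))/π) ≤ 1/√(1/r² + n/γ²)`.
[cite: BrakerskiEtAl2013, Lemmas 2.5, 2.9 and 4.9 (proof, "Using ‖z‖ ≤ √n")] -/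
theorem tvDist_noiseH₁_invScaled_le_of_binary {ε r γ : ℝ} (hε : 0 < ε) (hε' : ε ≤ 1 / 2) (hr : 0 < r)
    (hγ : 0 < γ) {z : Fin n → ℤ} (hz : ∀ j, z j = 0 ∨ z j = 1)
    (hsmooth : (Q : ℝ)⁻¹ * Real.sqrt (Real.log (2 * n * (1 + 1 / ε)) / π) ≤
      1 / Real.sqrt (1 / r ^ 2 + n / γ ^ 2)) :
    (noiseH₁ (latticeNoiseLaw (invScaledBasisZ n Q) r) (discretizedGaussian Q γ) (intCastVec z : Fin n → ZMod Q)).tvDist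
        (discretizedGaussian Q (Real.sqrt (‖WithLp.toLp 2 (fun j => (z j : ℝ))‖ ^ 2 * r ^ 2 + γ ^ 2))) ≤ 4 * ε := by
  refine tvDist_noiseH₁_invScaled_le hε hε' hr hγ z (hsmooth.trans ?_)
  -- `1/√(1/r² + n/γ²) ≤ 1/√(1/r² + (‖z̄‖/γ)²)` since `(‖z̄‖/γ)² ≤ n/γ²`
  have hzn := norm_toLp_intCast_sq_le_of_binary hz
  have h1 : (‖WithLp.toLp 2 (fun j => (z j : ℝ))‖ / γ) ^ 2 ≤ n / γ ^ 2 := by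
    rw [div_pow]
    exact div_le_div_of_nonneg_right hzn (by positivity)
  have hpos : 0 < Real.sqrt (1 / r ^ 2 + (‖WithLp.toLp 2 (fun j => (z j : ℝ))‖ / γ) ^ 2) :=
    Real.sqrt_pos.2 (by positivity)
  rw [one_div_le_one_div (Real.sqrt_pos.2 (by positivity)) hpos]
  exact Real.sqrt_le_sqrt (by linarith)

end LWE

end Literature.Computability.Cryptography

end
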